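import Summits.ValiantsHypothesis.ValiantsHypothesis.Theorems.FreeSubtorusOrbitDimensionBoundStubPerSummandPrelimB

/-!
# `OrbitDimensionBound` (stmt-ValiantsHypothesis-16133), rung line `sign_covering` — stub `stub_perSummand`,
# preliminaries C: a LOCAL direct summand carrying the irreducible determinant factor (Fitting)

Third tool file for stub 1 `stub_perSummand` of `Cruxes/OrbitDimensionBound/Lines/sign_covering.lean` (route
`FreeSubtorus`).  Main result `exists_local_retract`: an affine square matrix `M` over `ℂ[x_σ]` with
`det M = c · f`, `f` irreducible, `c ≠ 0`, has a RETRACT `N` (affine, size `≤` that of `M`, retract maps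
`v_W N = M v_V`, `u_W M = N u_V`, `u v = 1`) with `det N = c' · f`, `c' ≠ 0`, which is LOCAL: every endomorphism pair
`(g, h)` of `N` (`g N = N h`) has ONE common eigenvalue `μ` with `g − μ` and `h − μ` nilpotent.  (Induction on the
size: a non-local endomorphism pair has a weight of multiplicity `< m` in the graded square form of preliminaries A, the
matrix splits into two diagonal blocks, irreducibility of `f` puts `f` into one of them, and that block is a retract;
retracts compose.)  This is the Kronecker-module form of Fitting's lemma: the per-carrying indecomposable summand of
a determinantal representation of the permanent has a local endomorphism algebra.

Helper mode (`--supports stmt-ValiantsHypothesis-16133 --as helper`).  Honest framing: [folklore] linear algebra towards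
ONE registered stub of a dormant rung line; `OrbitDimensionBound`, `FreeSubtorus` and VP ≠ VNP are OPEN and not moved.

## References
* N. Jacobson, *Basic Algebra II*, 2nd ed. (1989), §3.4 (Fitting's lemma, Krull–Schmidt) — orientation only.
* [LandsbergRessayre2017] J. M. Landsberg, N. Ressayre, Differential Geom. Appl. 55 (2017), §3.3.
-/

set_option linter.dupNamespace false

namespace Summit.ValiantsHypothesis.ValiantsHypothesis.Theorems.FreeSubtorusOrbitDimensionBound.SignCovering.PerSummand

open Matrix MvPolynomial Finset Module.End
open Literature.Computability.AlgebraicComplexity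
open Summit.ValiantsHypothesis.ValiantsHypothesis.Theorems.FreeSubtorusConfusionCovering

/-! ### §1 Full multiplicity of a weight means nilpotency -/

section Nilpotent

/-- If the generalised eigenspace of `g` for `μ` is everything, `g − μ` is nilpotent. [folklore] -/
theorem isNilpotent_sub_of_finrank_maxGen_eq {m : ℕ} (g : Matrix (Fin m) (Fin m) ℂ) (μ : ℂ)
    (h : Module.finrank ℂ (Module.End.maxGenEigenspace (Matrix.toLin' g) μ) = m) :
    IsNilpotent (g - μ • (1 : Matrix (Fin m) (Fin m) ℂ)) := by
  set f : Module.End ℂ (Fin m → ℂ) := Matrix.toLin' g with hf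
  have htop : Module.End.maxGenEigenspace f μ = ⊤ := by
    apply Submodule.eq_top_of_finrank_eq
    rw [h, Module.finrank_fin_fun]
  have hk : LinearMap.ker ((f - μ • 1) ^ m) = ⊤ := by
    have h1 := Module.End.maxGenEigenspace_eq_genEigenspace_finrank f μ
    rw [htop, Module.finrank_fin_fun, Module.End.genEigenspace_nat] at h1
    exact h1.symm
  have hz : (f - μ • 1) ^ m = 0 := LinearMap.ker_eq_top.1 hk
  have hlin : Matrix.toLin' (g - μ • (1 : Matrix (Fin m) (Fin m) ℂ)) = f - μ • 1 := by
    rw [map_sub, map_smul, Matrix.toLin'_one, hf]; rfl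
  rw [← Matrix.isNilpotent_toLin'_iff, hlin]
  exact ⟨m, hz⟩

end Nilpotent

/-! ### §2 A diagonal block of a two-block matrix is a retract -/

section Block

variable {σ : Type*}

/-- **Block retract.**  If `M'` is block diagonal for the colouring `q` (both off-diagonal blocks vanish), then the
`q`-block, re-indexed by `Fin k` (`k = #q`), is a retract of `M'` through the inclusion / projection matrices, its entries
are entries of `M'`, and `det M' = det (q-block) · det (¬q-block)`. [folklore] -/
theorem block_retract {m k : ℕ} (M' : Matrix (Fin m) (Fin m) (MvPolynomial σ ℂ)) (q : Fin m → Prop)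
    [DecidablePred q] (h₁ : ∀ i j, q i → ¬ q j → M' i j = 0) (h₂ : ∀ i j, ¬ q i → q j → M' i j = 0)
    (e : {i // q i} ≃ Fin k) :
    ∃ (J : Matrix (Fin m) (Fin k) ℂ) (Jt : Matrix (Fin k) (Fin m) ℂ),
      J.map (C (σ := σ)) * (M'.toSquareBlockProp q).submatrix e.symm e.symm = M' * J.map (C (σ := σ)) ∧
      Jt.map (C (σ := σ)) * M' = (M'.toSquareBlockProp q).submatrix e.symm e.symm * Jt.map (C (σ := σ)) ∧
      Jt * J = 1 ∧
      M'.det = ((M'.toSquareBlockProp q).submatrix e.symm e.symm).det * (M'.toSquareBlockProp fun i => ¬ q i).det := by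
  classical
  set J : Matrix (Fin m) (Fin k) ℂ := Matrix.of fun i a => if i = (e.symm a).1 then 1 else 0 with hJ
  set Jt : Matrix (Fin k) (Fin m) ℂ := Matrix.of fun a i => if i = (e.symm a).1 then 1 else 0 with hJt
  have hinj : ∀ a b : Fin k, ((e.symm a).1 = (e.symm b).1) ↔ a = b := fun a b =>
    ⟨fun h => e.symm.injective (Subtype.ext h), fun h => by rw [h]⟩
  have hea : ∀ (i : Fin m) (hi : q i) (a : Fin k), a ≠ e ⟨i, hi⟩ → i ≠ (e.symm a).1 := by
    intro i hi a ha h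
    apply ha
    have h' : e.symm a = ⟨i, hi⟩ := Subtype.ext h.symm
    rw [← h', Equiv.apply_symm_apply]
  refine ⟨J, Jt, ?_, ?_, ?_, ?_⟩
  · -- `J N = M' J`
    apply Matrix.ext
    intro i b
    rw [Matrix.mul_apply, Matrix.mul_apply]
    have hR : ∑ l, M' i l * (J.map (C (σ := σ))) l b = M' i (e.symm b).1 := by
      rw [Finset.sum_eq_single (e.symm b).1]
      · simp [hJ]
      · intro l _ hl
        simp [hJ, hl]
      · intro h; exact absurd (Finset.mem_univ _) h
    rw [hR]
    by_cases hi : q i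
    · rw [Finset.sum_eq_single (e ⟨i, hi⟩)]
      · simp [hJ, Matrix.toSquareBlockProp_def]
      · intro a _ ha
        simp [hJ, hea i hi a ha]
      · intro h; exact absurd (Finset.mem_univ _) h
    · have hzero : M' i (e.symm b).1 = 0 := h₂ i _ hi (e.symm b).2
      rw [hzero]
      refine Finset.sum_eq_zero fun a _ => ?_
      have : i ≠ (e.symm a).1 := fun h => hi (h ▸ (e.symm a).2)
      simp [hJ, this]
  · -- `Jt M' = N Jt`
    apply Matrix.ext
    intro a l
    rw [Matrix.mul_apply, Matrix.mul_apply]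
    have hL : ∑ i, (Jt.map (C (σ := σ))) a i * M' i l = M' (e.symm a).1 l := by
      rw [Finset.sum_eq_single (e.symm a).1]
      · simp [hJt]
      · intro i _ hi
        simp [hJt, hi]
      · intro h; exact absurd (Finset.mem_univ _) h
    rw [hL]
    by_cases hl : q l
    · rw [Finset.sum_eq_single (e ⟨l, hl⟩)]
      · simp [hJt, Matrix.toSquareBlockProp_def]
      · intro b _ hb
        simp [hJt, hea l hl b hb]
      · intro h; exact absurd (Finset.mem_univ _) h
    · have hzero : M' (e.symm a).1 l = 0 := h₁ _ l (e.symm a).2 hl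
      rw [hzero]
      symm
      refine Finset.sum_eq_zero fun b _ => ?_
      have : l ≠ (e.symm b).1 := fun h => hl (h ▸ (e.symm b).2)
      simp [hJt, this]
  · -- `Jt J = 1`
    apply Matrix.ext
    intro a b
    rw [Matrix.mul_apply, Finset.sum_eq_single (e.symm a).1]
    · simp [hJ, hJt, Matrix.one_apply, hinj]
    · intro i _ hi
      simp [hJt, hi]
    · intro h; exact absurd (Finset.mem_univ _) h
  · -- determinant
    rw [Matrix.det_submatrix_equiv_self]
    exact Matrix.twoBlockTriangular_det M' q fun i hi j hj => h₂ i j hi hj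

end Block

/-! ### §3 The local per-carrying retract -/

section Local

variable {σ : Type*}

/-- A unit complement puts the irreducible factor into the other factor, with a non-zero constant. [folklore] -/
theorem eq_C_mul_of_mul_eq_C_mul_of_isUnit {f a b : MvPolynomial σ ℂ} {c : ℂ} (hc : c ≠ 0)
    (hab : a * b = C c * f) (hb : IsUnit b) : ∃ c' : ℂ, c' ≠ 0 ∧ a = C c' * f := by
  obtain ⟨r, hr, hbr⟩ := MvPolynomial.isUnit_iff_eq_C_of_isReduced.1 hb
  have hr0 : r ≠ 0 := hr.ne_zero
  refine ⟨c * r⁻¹, mul_ne_zero hc (inv_ne_zero hr0), ?_⟩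
  have h1 : a = a * b * C r⁻¹ := by
    rw [hbr, mul_assoc, ← map_mul, mul_inv_cancel₀ hr0, C_1, mul_one]
  rw [h1, hab, map_mul]; ring

/-- **Local per-carrying retract** (Fitting's lemma for square affine matrix pencils).  Let `f ∈ ℂ[x_σ]` be
irreducible.  Every affine `M ∈ M_m(ℂ[x_σ])` with `det M = c · f`, `c ≠ 0`, has an affine retract `N ∈ M_k(ℂ[x_σ])`,
`k ≤ m`, with `det N = c' · f`, `c' ≠ 0`, through complex matrices `v_W, v_V, u_W, u_V` (`v_W N = M v_V`,
`u_W M = N u_V`, `u_W v_W = 1 = u_V v_V`), such that `N` is LOCAL: for every `g, h ∈ M_k(ℂ)` with `g N = N h` there is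
`μ ∈ ℂ` with `g − μ` and `h − μ` nilpotent. [folklore] -/
theorem exists_local_retract {f : MvPolynomial σ ℂ} (hf : Irreducible f) (m : ℕ) :
    ∀ (M : Matrix (Fin m) (Fin m) (MvPolynomial σ ℂ)) (c : ℂ), c ≠ 0 →
      (∀ i j, (M i j).totalDegree ≤ 1) → M.det = C c * f →
      ∃ (k : ℕ) (N : Matrix (Fin k) (Fin k) (MvPolynomial σ ℂ)) (c' : ℂ)
        (vW vV : Matrix (Fin m) (Fin k) ℂ) (uW uV : Matrix (Fin k) (Fin m) ℂ),
        k ≤ m ∧ c' ≠ 0 ∧ (∀ i j, (N i j).totalDegree ≤ 1) ∧ N.det = C c' * f ∧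
        (∀ g h : Matrix (Fin k) (Fin k) ℂ, g.map C * N = N * h.map C →
          ∃ μ : ℂ, IsNilpotent (g - μ • (1 : Matrix (Fin k) (Fin k) ℂ)) ∧
            IsNilpotent (h - μ • (1 : Matrix (Fin k) (Fin k) ℂ))) ∧
        vW.map (C (σ := σ)) * N = M * vV.map (C (σ := σ)) ∧
        uW.map (C (σ := σ)) * M = N * uV.map (C (σ := σ)) ∧ uW * vW = 1 ∧ uV * vV = 1 := by
  classical
  induction m using Nat.strong_induction_on with
  | _ m ih =>
  intro M c hc haff hdet
  by_cases hloc : ∀ g h : Matrix (Fin m) (Fin m) ℂ, g.map C * M = M * h.map C →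
      ∃ μ : ℂ, IsNilpotent (g - μ • (1 : Matrix (Fin m) (Fin m) ℂ)) ∧ IsNilpotent (h - μ • (1 : Matrix (Fin m) (Fin m) ℂ))
  · -- `M` itself is local
    refine ⟨m, M, c, 1, 1, 1, 1, le_rfl, hc, haff, hdet, hloc, ?_, ?_, Matrix.mul_one _, Matrix.mul_one _⟩
    · rw [Matrix.map_one C C_0 C_1, Matrix.one_mul, Matrix.mul_one]
    · rw [Matrix.map_one C C_0 C_1, Matrix.one_mul, Matrix.mul_one]
  · -- a non-local endomorphism pair splits `M`
    push Not at hloc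
    obtain ⟨g, h, hgh, hnl⟩ := hloc
    have hf0 : f ≠ 0 := hf.ne_zero
    have hCc : (C c : MvPolynomial σ ℂ) ≠ 0 := fun h0 => hc (C_eq_zero.1 h0)
    have hM : M.det ≠ 0 := by rw [hdet]; exact mul_ne_zero hCc hf0
    obtain ⟨P, Q, β, hvan, hβg, hβh, -, -⟩ := exists_gradedSquareForm M hM g h hgh
    -- `m ≥ 1`
    have hm : 0 < m := by
      rcases Nat.eq_zero_or_pos m with h0 | h0
      · exfalso
        subst h0
        have h1 : M.det = 1 := Matrix.det_isEmpty
        rw [h1] at hdet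
        exact hf.not_isUnit (IsUnit.of_mul_eq_one_right _ hdet.symm)
      · exact h0
    set i₀ : Fin m := ⟨0, hm⟩ with hi₀
    set μ : ℂ := β i₀ with hμ
    let p : Fin m → Prop := fun i => β i = μ
    have hp₀ : p i₀ := rfl
    -- not all weights are `μ`
    have hnot : ∃ j, ¬ p j := by
      by_contra hall
      push Not at hall
      have hcardm : (univ.filter fun i => β i = μ).card = m := by
        rw [Finset.filter_true_of_mem fun i _ => hall i, card_univ, Fintype.card_fin]
      apply hnl μ
      · exact isNilpotent_sub_of_finrank_maxGen_eq g μ ((hβg μ).symm.trans hcardm)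
      · exact isNilpotent_sub_of_finrank_maxGen_eq h μ ((hβh μ).symm.trans hcardm)
    -- the conjugated matrix
    set Pm : Matrix (Fin m) (Fin m) ℂ := (P : Matrix (Fin m) (Fin m) ℂ) with hPm
    set Pi : Matrix (Fin m) (Fin m) ℂ := ((P⁻¹ : GL (Fin m) ℂ) : Matrix (Fin m) (Fin m) ℂ) with hPi
    set Qm : Matrix (Fin m) (Fin m) ℂ := (Q : Matrix (Fin m) (Fin m) ℂ) with hQm
    set Qi : Matrix (Fin m) (Fin m) ℂ := ((Q⁻¹ : GL (Fin m) ℂ) : Matrix (Fin m) (Fin m) ℂ) with hQi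
    have hPiP : Pi * Pm = 1 := by rw [hPi, hPm, ← Units.val_mul, inv_mul_cancel, Units.val_one]
    have hPPi : Pm * Pi = 1 := by rw [hPi, hPm, ← Units.val_mul, mul_inv_cancel, Units.val_one]
    have hQQi : Qm * Qi = 1 := by rw [hQi, hQm, ← Units.val_mul, mul_inv_cancel, Units.val_one]
    have hQiQ : Qi * Qm = 1 := by rw [hQi, hQm, ← Units.val_mul, inv_mul_cancel, Units.val_one]
    set M' : Matrix (Fin m) (Fin m) (MvPolynomial σ ℂ) := Pm.map C * M * Qm.map C with hM'
    have haff' : ∀ i j, (M' i j).totalDegree ≤ 1 := totalDegree_map_C_mul_mul_map_C_le Pm Qm haff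
    have hPdet : Pm.det ≠ 0 := by
      have h1 := congrArg Matrix.det hPPi
      rw [Matrix.det_mul, Matrix.det_one] at h1
      exact left_ne_zero_of_mul_eq_one h1
    have hQdet : Qm.det ≠ 0 := by
      have h1 := congrArg Matrix.det hQQi
      rw [Matrix.det_mul, Matrix.det_one] at h1
      exact left_ne_zero_of_mul_eq_one h1
    have hdet' : M'.det = C (Pm.det * Qm.det * c) * f := by
      rw [hM', det_map_C_mul_mul_map_C, hdet]; simp only [map_mul]; ring
    have hc₁ : Pm.det * Qm.det * c ≠ 0 := mul_ne_zero (mul_ne_zero hPdet hQdet) hc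
    -- iso retract `M' ↔ M`
    have hisoV : Pi.map (C (σ := σ)) * M' = M * Qm.map (C (σ := σ)) := by
      rw [hM', ← Matrix.mul_assoc, ← Matrix.mul_assoc, ← Matrix.map_mul, hPiP, Matrix.map_one C C_0 C_1,
        Matrix.one_mul]
    have hisoU : Pm.map (C (σ := σ)) * M = M' * Qi.map (C (σ := σ)) := by
      rw [hM', Matrix.mul_assoc, Matrix.mul_assoc, ← Matrix.map_mul, hQQi, Matrix.map_one C C_0 C_1,
        Matrix.mul_one]
    -- the generic block step, for a colouring `q` with a unit complementary block
    have step : ∀ (q : Fin m → Prop) [DecidablePred q], (∀ i j, q i → ¬ q j → M' i j = 0) →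
        (∀ i j, ¬ q i → q j → M' i j = 0) → (∃ j, ¬ q j) → IsUnit (M'.toSquareBlockProp fun i => ¬ q i).det →
        ∃ (k : ℕ) (N : Matrix (Fin k) (Fin k) (MvPolynomial σ ℂ)) (c' : ℂ)
          (vW vV : Matrix (Fin m) (Fin k) ℂ) (uW uV : Matrix (Fin k) (Fin m) ℂ),
          k ≤ m ∧ c' ≠ 0 ∧ (∀ i j, (N i j).totalDegree ≤ 1) ∧ N.det = C c' * f ∧
          (∀ g h : Matrix (Fin k) (Fin k) ℂ, g.map C * N = N * h.map C →
            ∃ μ : ℂ, IsNilpotent (g - μ • (1 : Matrix (Fin k) (Fin k) ℂ)) ∧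
              IsNilpotent (h - μ • (1 : Matrix (Fin k) (Fin k) ℂ))) ∧
          vW.map (C (σ := σ)) * N = M * vV.map (C (σ := σ)) ∧
          uW.map (C (σ := σ)) * M = N * uV.map (C (σ := σ)) ∧ uW * vW = 1 ∧ uV * vV = 1 := by
      intro q _ hq₁ hq₂ hqne hunit
      obtain ⟨j₀, hj₀⟩ := hqne
      set k₁ := Fintype.card {i // q i} with hk₁
      have hk₁m : k₁ < m := by
        have := Fintype.card_subtype_lt (p := q) hj₀
        rwa [Fintype.card_fin] at this
      obtain ⟨e₁⟩ : Nonempty ({i // q i} ≃ Fin k₁) := ⟨Fintype.equivFin {i // q i}⟩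
      obtain ⟨J, Jt, hJ, hJt, hJtJ, hdetM'⟩ := block_retract M' q hq₁ hq₂ e₁
      set N₁ : Matrix (Fin k₁) (Fin k₁) (MvPolynomial σ ℂ) := (M'.toSquareBlockProp q).submatrix e₁.symm e₁.symm
        with hN₁
      have haff₁ : ∀ a b, (N₁ a b).totalDegree ≤ 1 := fun a b => by
        rw [hN₁, Matrix.submatrix_apply, Matrix.toSquareBlockProp_def, Matrix.of_apply]; exact haff' _ _
      obtain ⟨c₁', hc₁', hdet₁⟩ : ∃ c' : ℂ, c' ≠ 0 ∧ N₁.det = C c' * f :=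
        eq_C_mul_of_mul_eq_C_mul_of_isUnit hc₁ (hdetM'.symm.trans hdet') hunit
      -- induction hypothesis for the block
      obtain ⟨k, N, c', v₁W, v₁V, u₁W, u₁V, hk, hc', haffN, hdetN, hlocN, hv₁, hu₁, huv₁W, huv₁V⟩ :=
        ih k₁ hk₁m N₁ c₁' hc₁' haff₁ hdet₁
      refine ⟨k, N, c', Pi * (J * v₁W), Qm * (J * v₁V), (u₁W * Jt) * Pm, (u₁V * Jt) * Qi,
        hk.trans hk₁m.le, hc', haffN, hdetN, hlocN, ?_, ?_, ?_, ?_⟩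
      · exact hom_comp (hom_comp hv₁ hJ) hisoV
      · exact hom_comp hisoU (hom_comp hJt hu₁)
      · calc u₁W * Jt * Pm * (Pi * (J * v₁W)) = u₁W * (Jt * ((Pm * Pi) * (J * v₁W))) := by
              simp only [Matrix.mul_assoc]
          _ = 1 := by rw [hPPi, Matrix.one_mul, ← Matrix.mul_assoc Jt, hJtJ, Matrix.one_mul, huv₁W]
      · calc u₁V * Jt * Qi * (Qm * (J * v₁V)) = u₁V * (Jt * ((Qi * Qm) * (J * v₁V))) := by
              simp only [Matrix.mul_assoc]
          _ = 1 := by rw [hQiQ, Matrix.one_mul, ← Matrix.mul_assoc Jt, hJtJ, Matrix.one_mul, huv₁V]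
    -- which block carries `f`?
    have hsplit : M'.det = (M'.toSquareBlockProp p).det * (M'.toSquareBlockProp fun i => ¬ p i).det :=
      det_eq_mul_of_graded M' β hvan p fun i j hi hj hij => hj (hij.symm.trans hi)
    have hirr : Irreducible (C (Pm.det * Qm.det * c) * f) :=
      (irreducible_isUnit_mul (((IsUnit.mk0 _ hc₁)).map C)).2 hf
    rcases hirr.isUnit_or_isUnit (hdet'.symm.trans hsplit) with hu | hu
    · -- the `p`-block is a unit: recurse into the `¬ p`-block
      refine step (fun i => ¬ p i) (fun i j hi hj => hvan i j fun hij => hi ?_)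
        (fun i j hi hj => hvan i j fun hij => hj ?_) ⟨i₀, fun h => h hp₀⟩ ?_
      · exact hij.trans (not_not.1 hj)
      · exact hij.symm.trans (not_not.1 hi)
      · rw [← Matrix.equiv_block_det M' fun i => (not_not : ¬¬p i ↔ p i)]; exact hu
    · -- the `¬ p`-block is a unit: recurse into the `p`-block
      exact step p (fun i j hi hj => hvan i j fun hij => hj (hij.symm.trans hi))
        (fun i j hi hj => hvan i j fun hij => hi (hij.trans hj)) hnot hu

end Local

end Summit.ValiantsHypothesis.ValiantsHypothesis.Theorems.FreeSubtorusOrbitDimensionBound.SignCovering.PerSummand
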